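import Summits.BirchSwinnertonDyer.BirchSwinnertonDyer.Theorems.ThetaPartnerAtTwoSignedKatoUpToAtTwoPlusHondaLogCharSum
import Summits.BirchSwinnertonDyer.BirchSwinnertonDyer.Theorems.ThetaPartnerAtTwoSignedKatoUpToAtTwoHondaLogCharSumsUnits
import Summits.BirchSwinnertonDyer.Rank1Residual.Additive.SignedTwistLocalGalois
import Summits.BirchSwinnertonDyer.Rank1Residual.F1Sign2.BranchCongruenceModTwoAtTwoHolds
import HarnessLib

/-!
# Route `ThetaPartnerAtTwo` (TP2), crux K3 `SignedKatoDivisibilityUpToAtTwo` (stmt-BirchSwinnertonDyer-20308 / K3P′ 25631), line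
# `colemanrat` v12 — (R3) IN THE PAIRING-SUM ENUMERATION: `Σ_{j<2ⁿ} χ(5)ʲ · log_Ê(g₀ʲ • d_n) = 3 · τ(χ)` for the displayed plus
# Honda point and every `g₀ ∈ Γ_{ℚ₂}` acting on `ζ_{2^{n+2}}` by the fifth power

Width seat `bsd-wall-tp2-p2x-w4` g0 (cell `bsd-wall`). HONEST FRAMING: theorems only (no definition, no named fact, no instance,
no `sorry`); closes no item; K3 / K3P′ are NOT settled and BSD is NOT proved by any of this.

## Why

The character-value sockets CORE_χ / CORE_χ^prim of the registered PUB stub read Kurihara's element at `χ(5) − 1` as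
`χ(P_{n,d_n}(z)) = Σ_{j<2ⁿ} ⟨z, gʲ • d_n⟩ · χ(5)ʲ` (`CoreChi.tsum_coeff_pairingSum_mul_pow_eq_sum`) — an enumeration of
`G_n = Gal(ℚ_{2,n}/ℚ₂)` by the powers of the local generator `g`. The lead's (R3) theorem
`PlusLayer.sum_mul_ptLogΩ_smul_plusHondaPoint_eq` (Kobayashi Prop. 8.26 at `2`, un-normalised) is a sum over a family
`τ_a ∈ Γ_{ℚ₂}`, `τ_a ζ_{2^{n+2}} = ζ_{2^{n+2}}^a`, over all residues `a`. With `χ₂(g₀) = 5` (`LocalVar.exists_localVariable_two`,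
this seat) the two enumerations are bridged here, so that the log half of Kobayashi's factorisation
`ψ(P_{n,d_n}(z)) = (Σ_σ ψ(σ) log d_n^σ)(Σ_σ ψ̄(σ) exp* z^σ)` (`HondaLog.sum_mul_trace_smul_mul_eq`) is available literally in the
`gʲ`-indexed form the assembly meets.

## What is here (displayed data `c, σ, d` of `PlusLayer.plusHondaSystemTwo_padic_withLog`: `c_m` fixed by `Stab(ζ_{2^m})`,
## `σ_m ζ_{2^m} = ζ_{2^m}⁻¹`, `d_n = 3•(c_{n+2} + σ_{n+2}•c_{n+2}) − 2•c_1`)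

* §1 `smul_towerPoint_eq_of_smul_zeta_eq`, `smul_towerPoint_one`: the Galois action on `c_m` factors through the action on
  `ζ_{2^m}`; every `ρ` fixes `c_1` (`ζ_2 = −1`). `smul_plusPoint_eq_of_smul_zeta_eq` / `smul_plusPoint_eq_of_smul_zeta_eq_inv`:
  `ρ • d_n` depends only on `ρ ζ_{2^{n+2}}` UP TO INVERSION (the plus point is symmetric under the inverter).
* §2 `exists_smul_zeta_eq_pow_of_isUnit`: every unit `a mod 2^m` is realised by some `ρ ∈ Γ_{ℚ₂}`, `ρ ζ_{2^m} = ζ_{2^m}^a`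
  (`Φ_{2^m}` irreducible over `ℚ₂`, `SignedTwist.irreducible_cyclotomic_prime_pow_padic` + `RootOfUnityAction.exists_smul_eq_pow_and_smul_eq_self`);
  `pow_neg_val_eq_inv` (`ζ^{(−a).val} = (ζ^{a.val})⁻¹`); re-indexing `ℤ/2ⁿ ↔ range 2ⁿ` is the tree's `F1Sign2.sum_zmod_val_eq_sum_range`.
* §3 **`sum_pow_mul_ptLogΩ_pow_smul_plusHondaPoint_eq`**: for every `n`, every `g₀ ∈ Γ_{ℚ₂}` with `g₀ ζ_{2^{n+2}} = ζ_{2^{n+2}}^5`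
  and every EVEN PRIMITIVE Dirichlet character `χ` mod `2^{n+2}` (values in `ℚ̄₂`):
  `Σ_{j<2ⁿ} χ(5)ʲ · Λ(toLoc⁻¹(g₀ʲ • d_n)) = 3 · τ(χ, ζ_{2^{n+2}})` — from the lead's `Σ_a χ(a)Λ(toLoc⁻¹(τ_a • d_n)) = 3(1+χ(−1))τ(χ)`,
  the units `±5ˢ` of `ℤ/2^{n+2}` (`HondaLogChi.sum_mulChar_eq_sum_pow_five_of_even`) and §1 (`τ_{±5ˢ} • d_n = g₀ˢ • d_n`).

References: [Kobayashi2003] §8.4 (Lemma 8.9), Prop. 8.25–8.26 (pp. 24–25), (8.23); [MazurTateTeitelbaum1986Invent] §I.13 (`ℤ₂ˣ = ±5^{ℤ₂}`);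
[Washington1997] Ch. 2 Thm. 2.5, §7.2.
-/

set_option autoImplicit false
-- the Theorems namespace of this sub repeats the summit name by design (D-0017 nested layout)
set_option linter.dupNamespace false

noncomputable section

open scoped Classical IntermediateField Topology NNReal NumberField

namespace Summit.BirchSwinnertonDyer.BirchSwinnertonDyer.Theorems.SignedKatoOffTwo.LocalVar

open Field WeierstrassCurve NumberField IsDedekindDomain Literature.NumberTheory.EllipticCurves
  Literature.NumberTheory.GaloisRepresentations
  Literature.NumberTheory.EllipticCurves.ZpExtension Literature.NumberTheory.EllipticCurves.Kobayashi2003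
  Literature.NumberTheory.EllipticCurves.FormalGroupChart Literature.NumberTheory.EllipticCurves.Rank1Residual
  Summit.BirchSwinnertonDyer.Rank1Residual.Additive Summit.BirchSwinnertonDyer.Rank1Residual.Additive.PadicCyclotomicTower
  Summit.BirchSwinnertonDyer.Rank1Residual.Additive.BallEval
  Summit.BirchSwinnertonDyer.BirchSwinnertonDyer.Theorems.SignedKatoOffTwo.LocalTwo
  Summit.BirchSwinnertonDyer.BirchSwinnertonDyer.Theorems.SignedKatoOffTwo.HondaLog
  Summit.BirchSwinnertonDyer.BirchSwinnertonDyer.Theorems.SignedEC.PlusLayer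

/-! ## §1 The Galois orbit of the tower points and of the plus point factors through the action on `ζ_{2^m}` -/

section Orbit

variable {W : WeierstrassCurve ℚ} {c : ℕ → localPoints W ℚ_[2]} {σ : ℕ → Field.absoluteGaloisGroup ℚ_[2]}
  {d : ℕ → localPoints W ℚ_[2]}

/-- **The action on `c_m` factors through the action on `ζ_{2^m}`**: if `ρ ζ_{2^m} = ρ' ζ_{2^m}` then `ρ • c_m = ρ' • c_m`
(`ρ'⁻¹ρ ∈ Stab(ζ_{2^m})` fixes `c_m`). [cite: Kobayashi2003, §8.4 (Lemma 8.9)] -/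
theorem smul_towerPoint_eq_of_smul_zeta_eq (hcstab : ∀ m, ∀ τ ∈ stab 2 m, τ • c m = c m) {m : ℕ}
    {ρ ρ' : Field.absoluteGaloisGroup ℚ_[2]} (h : ρ • zeta 2 m = ρ' • zeta 2 m) : ρ • c m = ρ' • c m := by
  have hmem : ρ'⁻¹ * ρ ∈ stab 2 m := by
    rw [mem_stab_iff, mul_smul, h, inv_smul_smul]
  calc ρ • c m = ρ' • ((ρ'⁻¹ * ρ) • c m) := by rw [mul_smul, smul_inv_smul]
    _ = ρ' • c m := by rw [hcstab m _ hmem]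

/-- **Every `ρ ∈ Γ_{ℚ₂}` fixes `c_1`** (`ζ_2 = −1 ∈ ℚ₂`, so `Stab(ζ_2) = Γ_{ℚ₂}`). [cite: Kobayashi2003, §8.4] -/
theorem smul_towerPoint_one (hcstab : ∀ m, ∀ τ ∈ stab 2 m, τ • c m = c m) (ρ : Field.absoluteGaloisGroup ℚ_[2]) :
    ρ • c 1 = c 1 := by
  refine hcstab 1 ρ ?_
  have hζ : zeta 2 1 = -1 := by
    have h := isPrimitiveRoot_zeta 2 1
    rw [pow_one] at h
    exact h.eq_neg_one_of_two_right
  rw [mem_stab_iff, hζ, smul_neg, smul_one]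

/-- The action of `ρ` on the displayed plus point: `ρ • d_n = 3•(ρ•c_{n+2} + (ρσ_{n+2})•c_{n+2}) − 2•c_1`. [cite: Kobayashi2003, §8.4] -/
theorem smul_plusPoint_eq (hcstab : ∀ m, ∀ τ ∈ stab 2 m, τ • c m = c m)
    (hd : ∀ n, d n = 3 • (c (n + 2) + σ (n + 2) • c (n + 2)) - 2 • c 1) (n : ℕ) (ρ : Field.absoluteGaloisGroup ℚ_[2]) :
    ρ • d n = 3 • (ρ • c (n + 2) + (ρ * σ (n + 2)) • c (n + 2)) - 2 • c 1 := by
  rw [hd n, smul_sub, smul_comm ρ (3 : ℕ), smul_comm ρ (2 : ℕ), smul_add, mul_smul, smul_towerPoint_one hcstab ρ]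

/-- **`ρ • d_n` depends only on `ρ ζ_{2^{n+2}}`**: `ρ ζ = ρ' ζ ⇒ ρ • d_n = ρ' • d_n`. [cite: Kobayashi2003, §8.4, Prop. 8.26] -/
theorem smul_plusPoint_eq_of_smul_zeta_eq (hcstab : ∀ m, ∀ τ ∈ stab 2 m, τ • c m = c m)
    (hσ : ∀ m, 1 ≤ m → σ m • zeta 2 m = (zeta 2 m)⁻¹)
    (hd : ∀ n, d n = 3 • (c (n + 2) + σ (n + 2) • c (n + 2)) - 2 • c 1) (n : ℕ)
    {ρ ρ' : Field.absoluteGaloisGroup ℚ_[2]} (h : ρ • zeta 2 (n + 2) = ρ' • zeta 2 (n + 2)) :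
    ρ • d n = ρ' • d n := by
  have h' : (ρ * σ (n + 2)) • zeta 2 (n + 2) = (ρ' * σ (n + 2)) • zeta 2 (n + 2) := by
    rw [mul_smul, mul_smul, hσ (n + 2) (by omega), smul_inv'', smul_inv'', h]
  rw [smul_plusPoint_eq hcstab hd n ρ, smul_plusPoint_eq hcstab hd n ρ', smul_towerPoint_eq_of_smul_zeta_eq hcstab h,
    smul_towerPoint_eq_of_smul_zeta_eq hcstab h']

/-- **… and only up to inversion**: `ρ ζ = (ρ' ζ)⁻¹ ⇒ ρ • d_n = ρ' • d_n` (the plus point is symmetric under the inverter: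
`ρ` acts on `c_{n+2}` like `ρ'σ` and on `σ c_{n+2}` like `ρ'`). [cite: Kobayashi2003, §8.4, Prop. 8.26] -/
theorem smul_plusPoint_eq_of_smul_zeta_eq_inv (hcstab : ∀ m, ∀ τ ∈ stab 2 m, τ • c m = c m)
    (hσ : ∀ m, 1 ≤ m → σ m • zeta 2 m = (zeta 2 m)⁻¹)
    (hd : ∀ n, d n = 3 • (c (n + 2) + σ (n + 2) • c (n + 2)) - 2 • c 1) (n : ℕ)
    {ρ ρ' : Field.absoluteGaloisGroup ℚ_[2]} (h : ρ • zeta 2 (n + 2) = (ρ' • zeta 2 (n + 2))⁻¹) :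
    ρ • d n = ρ' • d n := by
  have h1 : ρ • zeta 2 (n + 2) = (ρ' * σ (n + 2)) • zeta 2 (n + 2) := by
    rw [mul_smul, hσ (n + 2) (by omega), smul_inv'', h]
  have h2 : (ρ * σ (n + 2)) • zeta 2 (n + 2) = ρ' • zeta 2 (n + 2) := by
    rw [mul_smul, hσ (n + 2) (by omega), smul_inv'', h, inv_inv]
  rw [smul_plusPoint_eq hcstab hd n ρ, smul_plusPoint_eq hcstab hd n ρ', smul_towerPoint_eq_of_smul_zeta_eq hcstab h1,
    smul_towerPoint_eq_of_smul_zeta_eq hcstab h2, add_comm]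

end Orbit

/-! ## §2 Realising every unit `a mod 2^m` by a Galois element; re-indexing `ℤ/2ⁿ ↔ range 2ⁿ` -/

/-- **Every unit `a ∈ (ℤ/2^m)ˣ` is `ρ ↦ ρ ζ_{2^m} = ζ_{2^m}^a` for some `ρ ∈ Γ_{ℚ₂}`** (`Gal(ℚ₂(ζ_{2^m})/ℚ₂) = (ℤ/2^m)ˣ`:
`Φ_{2^m}` is irreducible over `ℚ₂`). [cite: SerreLocalFields1979, Ch. IV §4, Prop. 17] [cite: Washington1997, Ch. 2 Thm. 2.5] -/
theorem exists_smul_zeta_eq_pow_of_isUnit (m : ℕ) {a : ZMod (2 ^ m)} (ha : IsUnit a) :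
    ∃ ρ : Field.absoluteGaloisGroup ℚ_[2], ρ • zeta 2 m = zeta 2 m ^ a.val := by
  haveI : NeZero (2 ^ m) := ⟨pow_ne_zero _ two_ne_zero⟩
  have hirr : Irreducible (Polynomial.cyclotomic (2 ^ m * 1) ℚ_[2]) := by
    rw [mul_one]; exact SignedTwist.irreducible_cyclotomic_prime_pow_padic 2 m
  obtain ⟨ρ, hρ, -⟩ := RootOfUnityAction.exists_smul_eq_pow_and_smul_eq_self (K := ℚ_[2]) (B := 1)
    (Nat.coprime_one_right _) hirr ha.unit
  refine ⟨ρ, ?_⟩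
  rw [hρ (zeta 2 m) (zeta_pow_prime_pow_self (p := 2) m), IsUnit.unit_spec]

/-- `ζ^{(−a).val} = (ζ^{a.val})⁻¹` for `ζ^N = 1`, `ζ ≠ 0`, `a ∈ ℤ/N`. [folklore] -/
theorem pow_neg_val_eq_inv {F : Type*} [Field F] {N : ℕ} [NeZero N] {ζ : F} (hζ : ζ ^ N = 1) (a : ZMod N) :
    ζ ^ (-a).val = (ζ ^ a.val)⁻¹ := by
  have hζ0 : ζ ≠ 0 := by
    intro h
    rw [h, zero_pow (NeZero.ne N)] at hζ
    exact zero_ne_one hζ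
  rw [ZMod.neg_val]
  split_ifs with h
  · rw [h, ZMod.val_zero, pow_zero, inv_one]
  · rw [pow_sub₀ _ hζ0 (ZMod.val_lt a).le, hζ, one_mul]

/-! ## §3 (R3) in the pairing-sum enumeration -/

section Enum

open Rat.HeightOneSpectrum

/-- **Kobayashi Prop. 8.26 at `2` in the `gʲ`-enumeration.** For `W/ℚ` globally minimal and the displayed data of
`PlusLayer.plusHondaSystemTwo_padic_withLog` — tower points `c_m` with `toLoc⁻¹ c_m ∈ L(m) ∩ E₁`, `Λ(toLoc⁻¹ c_m) = ℓ_m`, fixed by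
`Stab(ζ_{2^m})`; inverters `σ_m`; `d_n = 3•(c_{n+2} + σ_{n+2}•c_{n+2}) − 2•c_1` — every `n`, every `g₀ ∈ Γ_{ℚ₂}` with
`g₀ ζ_{2^{n+2}} = ζ_{2^{n+2}}^5` and every EVEN PRIMITIVE Dirichlet character `χ` modulo `2^{n+2}`:
`Σ_{j<2ⁿ} χ(5)ʲ · Λ(toLoc⁻¹(g₀ʲ • d_n)) = 3 · Σ_a χ(a) ζ_{2^{n+2}}^a`. This is `PlusLayer.sum_mul_ptLogΩ_smul_plusHondaPoint_eq`
(`Σ_a χ(a)Λ(toLoc⁻¹(τ_a • d_n)) = 3(1+χ(−1))τ(χ)`) re-indexed by the units `±5ˢ` of `ℤ/2^{n+2}`, using that `τ_{±5ˢ}` and `g₀ˢ`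
have the same effect on `d_n` (§1). [cite: Kobayashi2003, Prop. 8.26 (p. 25), (8.23)] [cite: MazurTateTeitelbaum1986Invent, §I.13] -/
theorem sum_pow_mul_ptLogΩ_pow_smul_plusHondaPoint_eq (W : WeierstrassCurve ℚ) [W.IsElliptic] [W.IsGloballyMinimal]
    {c : ℕ → localPoints W ℚ_[2]} {σ : ℕ → Field.absoluteGaloisGroup ℚ_[2]} {d : ℕ → localPoints W ℚ_[2]}
    (hcΩ : haveI := isIntegral_genFib_baseChange 2 ((integralModelInt W).map (Int.castRingHom ℤ_[2]))
        ∀ m, (toLoc ((genFibΩ_eq_baseChange ((integralModelInt W).map (Int.castRingHom ℤ_[2]))).trans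
              (baseChange_twoAdicModel W))).symm (c m) ∈
            subfieldPoints (genFibΩ 2 ((integralModelInt W).map (Int.castRingHom ℤ_[2]))) (layer 2 m).toSubfield
              coeffs_mem_layer ∧
          (toLoc ((genFibΩ_eq_baseChange ((integralModelInt W).map (Int.castRingHom ℤ_[2]))).trans
              (baseChange_twoAdicModel W))).symm (c m) ∈
            kernel (Valued.v (R := PadicAlgCl 2)) (genFibΩ 2 ((integralModelInt W).map (Int.castRingHom ℤ_[2]))) ∧
          ptLogΩ 2 ((integralModelInt W).map (Int.castRingHom ℤ_[2]))
            ((toLoc ((genFibΩ_eq_baseChange ((integralModelInt W).map (Int.castRingHom ℤ_[2]))).trans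
              (baseChange_twoAdicModel W))).symm (c m)) = ell 2 m)
    (hcstab : ∀ m, ∀ τ ∈ stab 2 m, τ • c m = c m)
    (hσ : ∀ m, 1 ≤ m → σ m • zeta 2 m = (zeta 2 m)⁻¹)
    (hd : ∀ n, d n = 3 • (c (n + 2) + σ (n + 2) • c (n + 2)) - 2 • c 1)
    (n : ℕ) [NeZero (2 ^ (n + 2))] {g₀ : Field.absoluteGaloisGroup ℚ_[2]}
    (hg₀ : g₀ • zeta 2 (n + 2) = zeta 2 (n + 2) ^ 5)
    (χ : DirichletCharacter (PadicAlgCl 2) (2 ^ (n + 2))) (hχ : χ.IsPrimitive) (hev : χ (-1) = 1) :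
    haveI := isIntegral_genFib_baseChange 2 ((integralModelInt W).map (Int.castRingHom ℤ_[2]))
    ∑ j ∈ Finset.range (2 ^ n), χ (5 : ZMod (2 ^ (n + 2))) ^ j *
        ptLogΩ 2 ((integralModelInt W).map (Int.castRingHom ℤ_[2]))
          ((toLoc ((genFibΩ_eq_baseChange ((integralModelInt W).map (Int.castRingHom ℤ_[2]))).trans
            (baseChange_twoAdicModel W))).symm (g₀ ^ j • d n)) =
      3 * gaussSum χ (AddChar.zmodChar (2 ^ (n + 2)) (zeta_pow_prime_pow_self (p := 2) (n + 2))) := by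
  haveI hintΩ := isIntegral_genFib_baseChange 2 ((integralModelInt W).map (Int.castRingHom ℤ_[2]))
  set Λ : localPoints W ℚ_[2] → PadicAlgCl 2 := fun P ↦
    ptLogΩ 2 ((integralModelInt W).map (Int.castRingHom ℤ_[2]))
      ((toLoc ((genFibΩ_eq_baseChange ((integralModelInt W).map (Int.castRingHom ℤ_[2]))).trans
        (baseChange_twoAdicModel W))).symm P) with hΛ
  -- a Galois family `τ_a` with `τ_a ζ = ζ^a` on units
  have hex : ∀ a : ZMod (2 ^ (n + 2)), IsUnit a →
      ∃ ρ : Field.absoluteGaloisGroup ℚ_[2], ρ • zeta 2 (n + 2) = zeta 2 (n + 2) ^ a.val :=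
    fun a ha ↦ exists_smul_zeta_eq_pow_of_isUnit (n + 2) ha
  choose! τ hτ using hex
  -- the lead's (R3) for this family, re-indexed by the units `±5^s`
  have hR3 := sum_mul_ptLogΩ_smul_plusHondaPoint_eq W hcΩ hσ hd n τ hτ χ hχ
  rw [hev, HondaLogChi.sum_mulChar_eq_sum_pow_five_of_even n χ hev] at hR3
  -- powers of `g₀` on `ζ`
  have hζN : zeta 2 (n + 2) ^ 2 ^ (n + 2) = 1 := zeta_pow_prime_pow_self (p := 2) (n + 2)
  have hg₀j : ∀ j : ℕ, g₀ ^ j • zeta 2 (n + 2) = zeta 2 (n + 2) ^ 5 ^ j := by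
    intro j
    induction j with
    | zero => rw [pow_zero, one_smul, pow_zero, pow_one]
    | succ j ih => rw [pow_succ', mul_smul, ih, smul_pow', hg₀, ← pow_mul, ← pow_succ']
  have h5u : ∀ s : ℕ, IsUnit ((5 : ZMod (2 ^ (n + 2))) ^ s) := by
    intro s
    have h5 : IsUnit (5 : ZMod (2 ^ (n + 2))) := by
      have h := (ZMod.isUnit_iff_coprime 5 (2 ^ (n + 2))).mpr (Nat.Coprime.pow_right _ (by norm_num))
      exact_mod_cast h
    exact h5.pow s
  -- `τ_{5^s} • d_n = g₀^s • d_n` and `τ_{−5^s} • d_n = g₀^s • d_n`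
  have hval : ∀ s : ℕ, zeta 2 (n + 2) ^ ((5 : ZMod (2 ^ (n + 2))) ^ s).val = zeta 2 (n + 2) ^ 5 ^ s := by
    intro s
    have h5 : (5 : ZMod (2 ^ (n + 2))) ^ s = ((5 ^ s : ℕ) : ZMod (2 ^ (n + 2))) := by push_cast; rfl
    rw [h5, ZMod.val_natCast, ← pow_eq_pow_mod _ hζN]
  have hplus : ∀ s : ℕ, τ ((5 : ZMod (2 ^ (n + 2))) ^ s) • d n = g₀ ^ s • d n := by
    intro s
    refine smul_plusPoint_eq_of_smul_zeta_eq hcstab hσ hd n ?_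
    rw [hτ _ (h5u s), hval, hg₀j]
  have hminus : ∀ s : ℕ, τ (-(5 : ZMod (2 ^ (n + 2))) ^ s) • d n = g₀ ^ s • d n := by
    intro s
    refine smul_plusPoint_eq_of_smul_zeta_eq_inv hcstab hσ hd n ?_
    rw [hτ _ ((h5u s).neg), pow_neg_val_eq_inv hζN, hval, hg₀j]
  -- assemble
  have hsum : ∑ s : ZMod (2 ^ n), χ ((5 : ZMod (2 ^ (n + 2))) ^ s.val) *
      (Λ (τ ((5 : ZMod (2 ^ (n + 2))) ^ s.val) • d n) + Λ (τ (-(5 : ZMod (2 ^ (n + 2))) ^ s.val) • d n)) =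
      2 * ∑ j ∈ Finset.range (2 ^ n), χ (5 : ZMod (2 ^ (n + 2))) ^ j * Λ (g₀ ^ j • d n) := by
    rw [Finset.mul_sum, ← Summit.BirchSwinnertonDyer.Rank1Residual.F1Sign2.sum_zmod_val_eq_sum_range (2 ^ n)
      (fun j ↦ 2 * (χ (5 : ZMod (2 ^ (n + 2))) ^ j * Λ (g₀ ^ j • d n)))]
    refine Finset.sum_congr rfl fun s _ ↦ ?_
    rw [hplus, hminus, map_pow]
    ring
  have h2 : (2 : PadicAlgCl 2) ≠ 0 := two_ne_zero
  have key : 2 * ∑ j ∈ Finset.range (2 ^ n), χ (5 : ZMod (2 ^ (n + 2))) ^ j * Λ (g₀ ^ j • d n) =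
      2 * (3 * gaussSum χ (AddChar.zmodChar (2 ^ (n + 2)) (zeta_pow_prime_pow_self (p := 2) (n + 2)))) := by
    rw [← hsum, hR3]; ring
  exact mul_left_cancel₀ h2 key

end Enum

end Summit.BirchSwinnertonDyer.BirchSwinnertonDyer.Theorems.SignedKatoOffTwo.LocalVar

end
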